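import Mathlib
import Literature.NumberTheory.Transcendental.LinEDS
import Summits.KontsevichZagierPeriods.KontsevichZagierPeriods.Theorems.FurushoPentagonKernelModuloPeriodConjectureRowBitsParity
import HarnessLib

/-!
# `KernelModuloPeriodConjecture`, line `Sketch`: parity of an XOR-group of rows (engine v2, G1)

Crux `FurushoPentagon.KernelModuloPeriodConjecture` (stmt-KontsevichZagierPeriods-15058), line
`Sketch`, registered stub `stub_xorRows_parity` of the lead's skeleton (soundness of the GROUPED
rows of the kernel-checkable GF(2) rank engine `Literature/NumberTheory/Transcendental/LinEDS.lean`,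
needed from weight `15` on): the row of a group `g` of valid names is the XOR of the mod-2 rows
`LinEDS.rowBits k μ`, `μ ∈ g`; at a column `c` its bit is the parity of the SUM of the integer
matrix entries `LinEDS.entry k μ c`, i.e. the grouped mod-2 row is the shadow of the sum of the
integer rows of the group. Induction on `g` from the single-name parity E9
(`stub_rowBits_parity`), `Nat.testBit_xor` and `Int.odd_add`.

References: K. Ihara, M. Kaneko, D. Zagier, Compos. Math. 142 (2006) §2 [IharaKanekoZagier2006].
-/

namespace Summit.KontsevichZagierPeriods.FurushoPentagon.KernelModuloPeriodConjecture

open Literature.NumberTheory.Transcendental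

/-- The exclusive or of two bits, each recording the parity of an integer, records the parity of
the sum. [folklore] -/
theorem xorG1_xor_eq_true_iff {p q : Bool} {m n : ℤ} (hp : p = true ↔ Odd m)
    (hq : q = true ↔ Odd n) : (p ^^ q) = true ↔ Odd (m + n) := by
  rw [Int.odd_add, ← Int.not_odd_iff_even, ← hp, ← hq]
  cases p <;> cases q <;> simp

/-- Bit `c` of the XOR-fold of a list of bitsets is the parity of the sum of a list of integers,
as soon as this holds term by term. [folklore] -/
theorem xorG1_foldr_testBit_iff {ι : Type*} (r : ι → ℕ) (z : ι → ℤ) (c : ℕ) :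
    ∀ g : List ι, (∀ μ ∈ g, (r μ).testBit c = true ↔ Odd (z μ)) →
      (((g.map r).foldr (fun a b => a ^^^ b) 0).testBit c = true ↔ Odd ((g.map z).sum))
  | [], _ => by simp
  | μ :: g, h => by
    rw [List.map_cons, List.foldr_cons, List.map_cons, List.sum_cons, Nat.testBit_xor]
    exact xorG1_xor_eq_true_iff (h μ List.mem_cons_self)
      (xorG1_foldr_testBit_iff r z c g fun ν hν => h ν (List.mem_cons_of_mem μ hν))

/-- **G1 — parity of an XOR-group of rows** (registered stub `stub_xorRows_parity` of the lead's
skeleton, crux stmt-KontsevichZagierPeriods-15058, line `Sketch`). For a list `g` of valid names and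
a column `c`, bit `c` of the XOR of the rows `rowBits k μ` (`μ ∈ g`) is the parity of the sum of the
integer matrix entries `entry k μ c`: the grouped mod-2 row is the reduction of the sum of the
integer rows. [cite: IharaKanekoZagier2006, §2] -/
theorem stub_xorRows_parity :
    ∀ (k : ℕ) (g : List (List ℕ × List ℕ)), (∀ μ ∈ g, LinEDS.validName k μ = true) →
      ∀ c ∈ LinEDS.cols k,
        (((g.map (LinEDS.rowBits k)).foldr (fun a b => a ^^^ b) 0).testBit c = true ↔
          Odd ((g.map fun μ => LinEDS.entry k μ c).sum)) :=
  fun k g hg c hc => xorG1_foldr_testBit_iff (LinEDS.rowBits k) (fun μ => LinEDS.entry k μ c) c g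
    fun μ hμ => (stub_rowBits_parity k μ (hg μ hμ)).1 c hc

end Summit.KontsevichZagierPeriods.FurushoPentagon.KernelModuloPeriodConjecture
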